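import Summits.Schanuel.Schanuel.Theorems.RootDecomp1KSiegelFunctions09
import Literature.NumberTheory.DiophantineGeometry.PlaneCurveFunctionFieldProofs
import Literature.NumberTheory.DiophantineGeometry.FunctionFieldGenusRatPlacesProofs
import Literature.NumberTheory.DiophantineGeometry.FunctionFieldGenusProofs
import Literature.NumberTheory.DiophantineGeometry.FunctionFieldGenusRiemannTheoremProofs
import Mathlib.RingTheory.Spectrum.Maximal.Localization
import Mathlib.RingTheory.DedekindDomain.IntegralClosure

/-!
# RootDecomp1KSiegelFunctionsAll (part 01 of 03) — CENSUS PROVENANCE for lens-1 g71 NODE 31-G «SiegelFunctionsAll and the height binder HeightComparison PROVED hypothesis-free» (FLOOR G (a) of RULE K-R59 (ii); CLAIM 31-G L3188, NOTES L3189 / L3190 / L3193 (v3c digests of record); crit-1 (g13) VERDICT 31-G L3194: FLOOR G (a) CONTENT MET IN SCRATCH — THEOREM ×1 PAYABLE ON LANDING, PORT GO)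

(census-1 g26 record port. SOURCE: the lens's standalone HOME/decomp-schanuel-lens-1/g71/out/SiegelFunctionsAll.lean v3c sha256 e1ade63183dfe401… (804 l; = PlanG b3685036… on top of the LANDED tree port RootDecomp1KSiegelFunctions01–09 = K 4f39c136…, PORT LANDED 31 L3184, PORT IDENTITY 31 L3187) split BY THE LENS into portG/RootDecomp1KSiegelFunctionsAll01 69e9e04cfd00… (341 l) / 02 444c4e5c0a50… (314 l) / 03 20ceda62193a… (213 l), cum 3340325d… rc 0 · 0 sorries (lens farm; NOTE L3193); the critic re-checked v3 / v3c rc 0 · 0 sorries, `--axioms` standard on the heads, CONTROL ControlG rc 1 as designed (VERDICT 31-G (i)–(v)). The census takes the three lens parts as the bodies (the nested sections PlanG ⊃ S5 ⊃ Main are re-opened per part by the lens; the `attribute [instance]` line on the bundled-structure fields CurveModel.instField / .instAlgebra / .instAFF in part 01 is the lens's — the gate routes it to review), adding this provenance block, one-line docstrings for undocumented helpers (part 01: 6; statements quoted), and THREE PORT-SIDE MODIFIERS OF RECORD asked for / forced by the gate: (m1) part 01 `curveModel_nonempty`: the DEPRECATED `IsLocalization.integerNormalization_map_to_map` replaced by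 `IsLocalization.integerNormalization_spec` (b : K[X] with b ∈ M; three tokens adapted; VERDICT 31-G PORT GO «fix the two lint warnings»); (m2) part 02 `mem_of_ord_nonneg`: `omit [IsAlgFunctionField K F] in` (unused section variable); (m3) `exists_map_eq_C_mul` PRIVATE in part 01 (dedup.landed dry-run notice ≡ `Literature.NumberTheory.LFunctions.WeilFatou.exists_int_map_eq_C_mul`) with a PRIVATE copy in part 02 for `integralDegreeBound`; everything else = the lens's parts VERBATIM. Chain 01 ← …RootDecomp1KSiegelFunctions09 + Literature…PlaneCurveFunctionFieldProofs / FunctionFieldGenusRatPlacesProofs / FunctionFieldGenusProofs / FunctionFieldGenusRiemannTheoremProofs + Mathlib.RingTheory.Spectrum.Maximal.Localization / Mathlib.RingTheory.DedekindDomain.IntegralClosure, 02 ← 01, 03 ← 02; ONE namespace Summit.Schanuel.Schanuel.Theorems.RootDecomp1KSiegelFunctions (the node-31 namespace, extended); `--supports stmt-Schanuel-33364` (item OPEN; the heads decide no ∀-item of the route). HEADS (part 03): `theorem siegelFunctionsAll : SiegelFunctionsAll` and `theorem heightComparison : RootDecomp1KHeightGrading.HeightComparison` — node 12's (β) print binder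 DISCHARGED in the tree, hypothesis-free — via S1/S6a `curveModel_nonempty` / `modelExists`, S2 `degYBound` (part 01), S5 `integralDegreeBound` (part 02: valuation-integrality + `minpoly_map_eq_of_forall_mem` + `scaleRoots` over K(x) = K(1/x) + transcendence degree count), S6b `qdvd_relPoly_of_rel`, S3/S4 by the Literature Riemann inequality `degree_add_one_sub_ell_le_genus_holds` BY NAME, the compositions `siegelFunctions_of_model` / `siegelFunctionsAll_of` / `siegelFunctionsAll_of_integralDegreeBound` / `heightComparison_of_integralDegreeBound`; the eight ×0 corollaries `heightComparisonAt_of_geomIrreducible`, `thinFibreAt_of_geomIrreducible` (node 12's THEOREM A unconditional), `thinFibre_of_padicSubspace` (the K-line sector head with the height binder gone: PadicSubspace ∧ HeightOffAt m₀ ⇒ ThinFibre m₀), `b_of_padicSubspace`, `thinFibreAt_iff_levelFinite_of_lt` / `thinFibreAt_iff_bddLevelEmpty_of_lt` (THEOREM B unconditional), `thinFibreAt_grading_of_geomIrreducible`, `thinFibreAt_of_heightDecided`. VERDICT 31-G L3194 (crit-1 g13): «FLOOR G (a) CONTENT IS MET IN SCRATCH — THEOREM ×1 PAYABLE ON LANDING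 booked under RULE K-R59 (ii) for the registered contingent head heightComparison : HeightComparison (hypothesis-free)»; p2: the TALLY moves to lens-1 ×23 + THEOREM ×25 at the critic's PORT IDENTITY of the LANDED head (until then lens-1 ×22 + THEOREM ×24); p3 (automatic, ×0): the K-line (β)-binder DISCHARGED — antecedents left PadicSubspace ∧ HeightOffAt m₀; node 12's THEOREMS A / B unconditional; census LIVENESS-v50 re-points the 13 conditional rows of v49 to reached BY NAME. Nothing here proves Schanuel, 33364, 33363, 31077 or 31987; rung 0; the THEOREM ×1 of RULE K-R59 (ii) is paid at the critic's PORT IDENTITY 31-G, not by this file.)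
-/

/-!
# RootDecomp1KSiegelFunctionsAll01 — lens 1, generation 71, NODE 31-G «`SiegelFunctionsAll` and the height binder `HeightComparison`
PROVED hypothesis-free» (FLOOR G (a) CONTENT of VERDICT 31 L3175 / ACK L3183; CLAIM 31-G L3188): PlanG v3 (HOME
decomp-schanuel-lens-1/g71/out/PlanG.lean, 727 l, sorry-free) on top of the landed record port `RootDecomp1KSiegelFunctions01–09`
(K 4f39c136…), split in three parts `…SiegelFunctionsAll01–03` (01 = S1/S6a CONSTRUCTION `CurveModel`/`SiegelModel`, `modelExists`, S2
`degYBound`, the statements `ModelExists`/`DegYBound`/`IntegralDegreeBound`, clearing of denominators; 02 = S5 `integralDegreeBound`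
(valuation-integrality ⇒ `K[g]`-coefficients of the minimal polynomial, `scaleRoots` comparison over `K(x) = K(1/x)`, transcendence degree
count); 03 = S6b `qdvd_relPoly_of_rel`, S3/S4 by the Literature Riemann inequality BY NAME, the compositions, and the hypothesis-free heads
`theorem siegelFunctionsAll : SiegelFunctionsAll`, `theorem heightComparison : …RootDecomp1KHeightGrading.HeightComparison`).
ONE namespace `Summit.Schanuel.Schanuel.Theorems.RootDecomp1KSiegelFunctions`; hygiene as the K port (NODE-g71.md §3c (iv)); three
instance ATTRIBUTES on the bundled-structure fields `CurveModel.instField/.instAlgebra/.instAFF` (part 01).  — part 01: the model (S1, S6a, S2) and the statements.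
-/

noncomputable section

namespace Summit.Schanuel.Schanuel.Theorems.RootDecomp1KSiegelFunctions

open Polynomial
open scoped Nat
open Summit.Schanuel.Schanuel.Theorems.RootDecomp1KDegreeLadder (bev xdeg natDegree_coeff_le_xdeg ThinFibreAt ThinFibre
  thinFibreAt_of_natDegree_lt)
open Summit.Schanuel.Schanuel.Theorems.RootDecomp1KHeightGrading

open Literature.NumberTheory.DiophantineGeometry
open Literature.NumberTheory.DiophantineGeometry.AlgFunctionField
open scoped IntermediateField

/-! ### PLAN (G) — a typed, kernel-checked skeleton for `SiegelFunctionsAll` (FLOOR G (a), steps S1–S6)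

This section is NOT part of the K file or the port.  It is SORRY-FREE (v3, 2026-09-02 ~09:40Z): all six steps S1–S6 are proved and
`theorem siegelFunctionsAll : SiegelFunctionsAll` / `theorem heightComparison : HeightComparison` (tree binder BY NAME) close hypothesis-free.
It is appended to a scratch copy of the K file (`out/PlanGK.lean` = K with one extra import
`Literature.NumberTheory.DiophantineGeometry.PlaneCurveFunctionFieldProofs` + `FunctionFieldGenusRatPlacesProofs` + `FunctionFieldGenusProofs` +
`FunctionFieldGenusRiemannTheoremProofs` + `Mathlib.RingTheory.Spectrum.Maximal.Localization` + `Mathlib.RingTheory.DedekindDomain.IntegralClosure` ++ this section) and checked with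
`lean check --json`: rc 0, sorries = 0; every declaration's axioms are
`[propext, Classical.choice, Quot.sound]` (probed with `--axioms`, see `out/plang_ax_*.json`).

* `CurveModel K Φ` / `SiegelModel P := CurveModel ℚ (ratModel P)` (S1 + S6a, the CONSTRUCTION): a function field `F/K` of one
  variable with marked elements `x, y`, `[F : K(x)] = deg_Y Φ`, evaluation kernel of `aevalAeval x y : K[x][Y] → F` equal to
  `(Φ)`, and every element of `F` a quotient `G(x,y)/H(x,y)`.  PROVED: `curveModel_nonempty` (any field `K`, any irreducible
  `Φ` of positive `Y`-degree: `AdjoinRoot` over `RatFunc K`, Gauss's lemma for the primitive `Φ`, power basis + clearing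
  denominators), `modelExists : ModelExists` (geometric irreducibility ⇒ irreducible `ℚ`-model), `SiegelModel.exists_frac_int`
  (integer numerators/denominators), `SiegelModel.transcendental_x/_y` (from the kernel and `deg_Y P, deg_x P ≥ 1`).
* `DegYBound` (S2): `deg (y)_∞ ≤ xdeg P` in any model — PROVED (`finrank_adjoin_y_le`, `degYBound`).
* `IntegralDegreeBound` (S5, PROVED v3 — `integralDegreeBound`): `z ∈ ℒ(a·(x)_∞)` satisfies an integral relation over `ℤ[x]`
  `D z^m + Σ_{i=1}^{m} χ_i(x) z^{m-i} = 0`, `D ≠ 0`, `deg χ_i ≤ a·i` (integrality: Literature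
  `isIntegralElem_of_forall_mem`; the degree bound: the same integrality over `K[1/x]` applied to `z·x^{-a}` plus
  `minpoly.isIntegrallyClosed_eq_field_fractions'`).
* S3 (Riemann) and S4 (divisor arithmetic) are the Literature theorems `degree_add_one_sub_ell_le_genus_holds`,
  `degree_negPart_principalDivisor_eq`, `mul_mem_riemannRochSpace_add`, `pow_mem_riemannRochSpace_nsmul`,
  `mem_riemannRochSpace_negPart_principalDivisor`, `exists_mem_ne_zero_of_ell_pos` — used BY NAME below.
* S6b (back-translation of a relation in `F` to `QDvd P (relPoly …)`) is PROVED: `qdvd_relPoly_of_rel`.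
* COMPOSITION (sorry-free): `siegelFunctions_of_model`, `siegelFunctionsAll_of`, `heightComparison_of_plan`, and the
  ONE-HYPOTHESIS reductions `siegelFunctionsAll_of_integralDegreeBound : IntegralDegreeBound → SiegelFunctionsAll`,
  `heightComparison_of_integralDegreeBound : IntegralDegreeBound → HeightComparison` (tree binder BY NAME)
  — with `a := ⌈(b·k + g)/n⌉ = ⌊(b·k + g + n − 1)/n⌋`, `c := g + n − 1` (`g` = the genus of the chosen model). -/

/-- A function-field model of the plane curve `Φ(x, Y) = 0` over a field `K` (`Φ ∈ K[x][Y]`): an algebraic function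
field `F/K` with two marked elements `x, y`, `[F : K(x)] = deg_Y Φ`, relation ideal `(Φ)`, and `F = K(x, y)` in
cleared form. -/
structure CurveModel (K : Type) [Field K] (Φ : K[X][X]) : Type 1 where
  /-- the function field -/
  F : Type
  [instField : Field F]
  [instAlgebra : Algebra K F]
  [instAFF : IsAlgFunctionField K F]
  /-- the two coordinate functions -/
  x : F
  y : F
  /-- `[F : K(x)] = deg_Y Φ` -/
  finrank_eq : Module.finrank K⟮x⟯ F = Φ.natDegree
  /-- the kernel of `K[x][Y] → F` is `(Φ)` -/
  ker_iff : ∀ R : K[X][X], aevalAeval x y R = 0 ↔ Φ ∣ R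
  /-- `F = K(x, y)`, in cleared form -/
  exists_frac : ∀ z : F, ∃ G H : K[X][X], aevalAeval x y H ≠ 0 ∧ z * aevalAeval x y H = aevalAeval x y G

attribute [instance] CurveModel.instField CurveModel.instAlgebra CurveModel.instAFF

/-- S1 + S6a (CONSTRUCTION statement): a function-field model of the integer plane curve `P(x, Y) = 0` is a
`CurveModel` over `ℚ` of its `ℚ`-model. -/
abbrev SiegelModel (P : ℤ[X][X]) : Type 1 := CurveModel ℚ (ratModel P)

/-- `(R : ℤ[X][X]) : (ratModel R).natDegree = R.natDegree`. -/
theorem natDegree_ratModel (R : ℤ[X][X]) : (ratModel R).natDegree = R.natDegree :=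
  natDegree_map_eq_of_injective (map_injective _ (RingHom.injective_int _)) R

/-- `(R : ℤ[X][X]) : (Bivariate.swap (ratModel R)).natDegree = xdeg R`. -/
theorem natDegree_swap_ratModel (R : ℤ[X][X]) : (Bivariate.swap (ratModel R)).natDegree = xdeg R := by
  rw [← ratModel_swap, natDegree_ratModel, natDegree_swap]

/-- In a model, `x` is transcendental over `K` (because `deg_Y Φ ≥ 1`). -/
theorem CurveModel.transcendental_x {K : Type} [Field K] {Φ : K[X][X]} (M : CurveModel K Φ) (hn : 1 ≤ Φ.natDegree) :
    Transcendental K M.x := by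
  rintro ⟨μ, hμ0, hμ⟩
  have hdvd : Φ ∣ C μ := (M.ker_iff _).1 (by rw [aevalAeval_C, hμ])
  have h := natDegree_le_of_dvd hdvd (C_ne_zero.2 hμ0)
  rw [natDegree_C] at h
  omega

/-- `{K F : Type*} [CommRing K] [CommRing F] [Algebra K F] (x₀ y₀ : F) (μ : K[X]) : aevalAeval x₀ y₀ (μ.map C) = aeval y₀ μ`. -/
theorem aevalAeval_map_C {K F : Type*} [CommRing K] [CommRing F] [Algebra K F] (x₀ y₀ : F) (μ : K[X]) :
    aevalAeval x₀ y₀ (μ.map C) = aeval y₀ μ := by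
  induction μ using Polynomial.induction_on' with
  | add p q hp hq => rw [Polynomial.map_add, map_add, map_add, hp, hq]
  | monomial n q =>
    rw [← C_mul_X_pow_eq_monomial, Polynomial.map_mul, Polynomial.map_pow, Polynomial.map_C, map_X, map_mul,
      map_pow, aevalAeval_C, aevalAeval_Y, map_mul, map_pow, aeval_C, aeval_C, aeval_X]

/-- In a model, `y` is transcendental over `K` (because `deg_x Φ ≥ 1`). -/
theorem CurveModel.transcendental_y {K : Type} [Field K] {Φ : K[X][X]} (M : CurveModel K Φ)
    (hk : 1 ≤ (Bivariate.swap Φ).natDegree) : Transcendental K M.y := by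
  rintro ⟨μ, hμ0, hμ⟩
  obtain ⟨T, hT⟩ : Φ ∣ μ.map C := (M.ker_iff _).1 (by rw [aevalAeval_map_C, hμ])
  have hdvd' : Bivariate.swap Φ ∣ C μ := ⟨Bivariate.swap T, by rw [← map_mul, ← hT, Bivariate.swap_map_C]⟩
  have h := natDegree_le_of_dvd hdvd' (C_ne_zero.2 hμ0)
  rw [natDegree_C] at h
  omega

/-- `{P : ℤ[X][X]} (M : SiegelModel P) (hn : 1 ≤ P.natDegree) : Transcendental ℚ M.x`. -/
theorem SiegelModel.transcendental_x {P : ℤ[X][X]} (M : SiegelModel P) (hn : 1 ≤ P.natDegree) : Transcendental ℚ M.x :=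
  CurveModel.transcendental_x M (by rw [natDegree_ratModel]; exact hn)

/-- `{P : ℤ[X][X]} (M : SiegelModel P) (hk : 1 ≤ xdeg P) : Transcendental ℚ M.y`. -/
theorem SiegelModel.transcendental_y {P : ℤ[X][X]} (M : SiegelModel P) (hk : 1 ≤ xdeg P) : Transcendental ℚ M.y :=
  CurveModel.transcendental_y M (by rw [natDegree_swap_ratModel]; exact hk)

/-- S1 + S6a as one statement. -/
def ModelExists : Prop :=
  ∀ P : ℤ[X][X], GeomIrreducible P → 1 ≤ xdeg P → 1 ≤ P.natDegree → Nonempty (SiegelModel P)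

/-- S2: the pole divisor of `y` has degree `≤ xdeg P` (in fact `= [F : ℚ(y)] = xdeg P`). -/
def DegYBound : Prop :=
  ∀ P : ℤ[X][X], 1 ≤ xdeg P → ∀ M : SiegelModel P, Divisor.degree (principalDivisor ℚ M.y)⁻ ≤ (xdeg P : ℤ)

/-- S5: an element of `ℒ(a·(x)_∞)` is integral over `ℤ[x]` (after clearing one integer `D`) with the degree of the
`i`-th coefficient at most `a·i`. -/
def IntegralDegreeBound : Prop :=
  ∀ (F : Type) [Field F] [Algebra ℚ F] [IsAlgFunctionField ℚ F] (x₀ : F), Transcendental ℚ x₀ →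
    ∀ (a : ℕ) (z : F), z ∈ riemannRochSpace (a • (principalDivisor ℚ x₀)⁻) →
      ∃ (m : ℕ) (D : ℤ) (χ : ℕ → ℤ[X]), D ≠ 0 ∧ (∀ i, (χ i).natDegree ≤ a * i) ∧
        (D : F) * z ^ m + ∑ i ∈ Finset.Icc 1 m, aeval x₀ ((χ i).map (Int.castRingHom ℚ)) * z ^ (m - i) = 0

/-- `(N : ℤ) : ratModel (C (C N)) = C (C (N : ℚ))`. -/
theorem ratModel_C_C (N : ℤ) : ratModel (C (C N)) = C (C (N : ℚ)) := by
  rw [ratModel_C, Polynomial.map_C, eq_intCast]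

/-- clearing denominators, one variable: `q = q'/N` with `q' ∈ ℤ[x]`, `N ∈ ℤ ∖ 0`.
(PORT NOTE, census-1 g26: PRIVATE — the statement is identical to the tree's
`Literature.NumberTheory.LFunctions.WeilFatou.exists_int_map_eq_C_mul` (WeilConjecturesFatouProofs.lean l.236, outside this file's import
closure and foreign to its subject); the gate's `dedup.landed` lint forbids a public restatement (dry-run of part 01); the lens's statement and
proof are kept verbatim under `private`, and part 02 carries its own private copy for `integralDegreeBound` (precedents p850098 / p850627 /
p850703).) -/
private theorem exists_map_eq_C_mul (q : ℚ[X]) :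
    ∃ (N : ℤ) (q' : ℤ[X]), N ≠ 0 ∧ q'.map (Int.castRingHom ℚ) = C (N : ℚ) * q := by
  induction q using Polynomial.induction_on' with
  | add p r hp hr =>
    obtain ⟨N₁, p', h1, hp'⟩ := hp
    obtain ⟨N₂, r', h2, hr'⟩ := hr
    refine ⟨N₁ * N₂, C N₂ * p' + C N₁ * r', mul_ne_zero h1 h2, ?_⟩
    rw [Polynomial.map_add, Polynomial.map_mul, Polynomial.map_mul, hp', hr', Polynomial.map_C, Polynomial.map_C,
      eq_intCast, eq_intCast, Int.cast_mul, C_mul]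
    ring
  | monomial n c =>
    refine ⟨c.den, monomial n c.num, by exact_mod_cast c.den_pos.ne', ?_⟩
    rw [Polynomial.map_monomial, eq_intCast, Int.cast_natCast, C_mul_monomial, Rat.den_mul_eq_num]

/-- clearing denominators, two variables: `G = G'/N` with `G' ∈ ℤ[x][Y]`, `N ∈ ℤ ∖ 0`. -/
theorem exists_ratModel_eq_C_mul (G : ℚ[X][X]) :
    ∃ (N : ℤ) (G' : ℤ[X][X]), N ≠ 0 ∧ ratModel G' = C (C (N : ℚ)) * G := by
  induction G using Polynomial.induction_on' with
  | add p r hp hr =>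
    obtain ⟨N₁, p', h1, hp'⟩ := hp
    obtain ⟨N₂, r', h2, hr'⟩ := hr
    refine ⟨N₁ * N₂, C (C N₂) * p' + C (C N₁) * r', mul_ne_zero h1 h2, ?_⟩
    rw [ratModel_add, ratModel_mul, ratModel_mul, hp', hr', ratModel_C_C, ratModel_C_C, Int.cast_mul, C_mul, C_mul]
    ring
  | monomial n q =>
    obtain ⟨N, q', hN, hq'⟩ := exists_map_eq_C_mul q
    refine ⟨N, monomial n q', hN, ?_⟩
    rw [ratModel_apply, Polynomial.map_monomial, coe_mapRingHom, hq', C_mul_monomial]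

/-- **The model exists** for every irreducible `Φ ∈ K[x][Y]` of positive `Y`-degree: `F = K(x)[Y]/(Φ)` (`AdjoinRoot`
over `RatFunc K`; `Φ` stays irreducible over `K(x)` by Gauss), an algebraic function field over `K` with
`[F : K(x)] = deg_Y Φ`, relation ideal `(Φ)` (Gauss's lemma for the primitive `Φ`), and every element a quotient
`G(x,y)/b(x)` (power basis + clearing denominators). -/
theorem curveModel_nonempty (K : Type) [Field K] {Φ : K[X][X]} (hirr : Irreducible Φ) (hn : 1 ≤ Φ.natDegree) :
    Nonempty (CurveModel K Φ) := by
  classical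
  have hprim : Φ.IsPrimitive := hirr.isPrimitive (by omega)
  set f : (RatFunc K)[X] := Φ.map (algebraMap K[X] (RatFunc K)) with hf
  have hfirr : Irreducible f := (hprim.irreducible_iff_irreducible_map_fraction_map (K := RatFunc K)).1 hirr
  haveI : Fact (Irreducible f) := ⟨hfirr⟩
  set pb := AdjoinRoot.powerBasis hfirr.ne_zero with hpb
  have hfdeg : f.natDegree = Φ.natDegree := by
    rw [hf, natDegree_map_eq_of_injective (IsFractionRing.injective K[X] (RatFunc K))]
  have hdim : pb.dim = Φ.natDegree := by rw [hpb, AdjoinRoot.powerBasis_dim, hfdeg]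
  haveI hAFF : IsAlgFunctionField K (AdjoinRoot f) := isAlgFunctionField_of_powerBasis pb
  set x : AdjoinRoot f := algebraMap K[X] (AdjoinRoot f) X with hx
  have hev : ∀ R : K[X][X],
      aevalAeval x (AdjoinRoot.root f) R = AdjoinRoot.mk f (R.map (algebraMap K[X] (RatFunc K))) := by
    intro R
    induction R using Polynomial.induction_on' with
    | add p q hp hq => rw [map_add, Polynomial.map_add, map_add, hp, hq]
    | monomial n c =>
      rw [← C_mul_X_pow_eq_monomial, map_mul, map_pow, aevalAeval_C, aevalAeval_Y, hx, aeval_algebraMap_X_eq,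
        Polynomial.map_mul, Polynomial.map_pow, Polynomial.map_C, map_X, map_mul, map_pow, AdjoinRoot.mk_C,
        AdjoinRoot.mk_X, AdjoinRoot.algebraMap_eq', RingHom.comp_apply]
  refine ⟨CurveModel.mk (AdjoinRoot f) x (AdjoinRoot.root f) ?_ ?_ ?_⟩
  · rw [hx, finrank_adjoin_algebraMap_X_eq_dim pb, hdim]
  · intro R
    rw [hev, AdjoinRoot.mk_eq_zero, hf]
    exact (hprim.dvd_iff_fraction_map_dvd_fraction_map (K := RatFunc K)).symm
  · intro z
    obtain ⟨p, rfl⟩ := AdjoinRoot.mk_surjective z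
    -- PORT NOTE (census-1 g26): the lens's `IsLocalization.integerNormalization_map_to_map` is DEPRECATED in the tree's Mathlib
    -- (lint.warning would bounce the part); replaced by `IsLocalization.integerNormalization_spec` (b : K[X] with b ∈ M instead of b : ↥M) —
    -- the same argument, three tokens adapted (`C b`, `nonZeroDivisors.ne_zero hbM`, `algebraMap_smul … b p`).
    obtain ⟨b, hbM, hbp⟩ := IsLocalization.integerNormalization_spec (nonZeroDivisors K[X]) p
    refine ⟨IsLocalization.integerNormalization (nonZeroDivisors K[X]) p, C b, ?_, ?_⟩
    · rw [hev, Polynomial.map_C, Ne, AdjoinRoot.mk_eq_zero]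
      intro hdvd
      have hb0 : algebraMap K[X] (RatFunc K) b ≠ 0 :=
        (map_ne_zero_iff _ (IsFractionRing.injective K[X] (RatFunc K))).2 (nonZeroDivisors.ne_zero hbM)
      have h := natDegree_le_of_dvd hdvd (C_ne_zero.2 hb0)
      rw [natDegree_C] at h
      omega
    · rw [hev, hev, Polynomial.map_C, ← map_mul, hbp, ← algebraMap_smul (RatFunc K) b p, smul_eq_C_mul,
        mul_comm]

/-- **S1 + S6a (PROVED): the model exists** for every geometrically irreducible integer `P` with `deg_Y P ≥ 1`
(geometric irreducibility ⇒ irreducibility of the `ℚ`-model, K's `irreducible_ratModel_of_geomIrreducible`). -/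
theorem modelExists : ModelExists := fun _ hgi _ hn ↦
  curveModel_nonempty ℚ (irreducible_ratModel_of_geomIrreducible hgi hn) (by rw [natDegree_ratModel]; exact hn)

/-- clearing the rational denominators: every element of a model of `P` is `G(x,y)/H(x,y)` with INTEGER `G, H`. -/
theorem SiegelModel.exists_frac_int {P : ℤ[X][X]} (M : SiegelModel P) (z : M.F) :
    ∃ G H : ℤ[X][X], aevalAeval M.x M.y (ratModel H) ≠ 0 ∧
      z * aevalAeval M.x M.y (ratModel H) = aevalAeval M.x M.y (ratModel G) := by
  obtain ⟨G, H, hH, hz⟩ := M.exists_frac z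
  obtain ⟨N₁, G', hN₁, hG'⟩ := exists_ratModel_eq_C_mul G
  obtain ⟨N₂, H', hN₂, hH'⟩ := exists_ratModel_eq_C_mul H
  have hCC : ∀ N : ℤ, aevalAeval M.x M.y (C (C (N : ℚ))) = (N : M.F) := fun N ↦ by
    rw [aevalAeval_C, aeval_C, map_intCast]
  have hN₁' : (N₁ : M.F) ≠ 0 := by
    rw [← map_intCast (algebraMap ℚ M.F)]
    exact (_root_.map_ne_zero _).2 (Int.cast_ne_zero.2 hN₁)
  have hN₂' : (N₂ : M.F) ≠ 0 := by
    rw [← map_intCast (algebraMap ℚ M.F)]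
    exact (_root_.map_ne_zero _).2 (Int.cast_ne_zero.2 hN₂)
  refine ⟨C (C N₂) * G', C (C N₁) * H', ?_, ?_⟩
  · rw [ratModel_mul, ratModel_C_C, hH', map_mul, map_mul, hCC, hCC]
    exact mul_ne_zero hN₁' (mul_ne_zero hN₂' hH)
  · rw [ratModel_mul, ratModel_C_C, hH', map_mul, map_mul, hCC, hCC, ratModel_mul, ratModel_C_C, hG', map_mul, map_mul,
      hCC, hCC, ← hz]
    ring

/-- Every polynomial value `R(x, y)` lies in any intermediate field (over `L = ℚ(y)`) containing `x` and `y`. -/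
theorem aevalAeval_mem {F : Type*} [Field F] [Algebra ℚ F] {L : IntermediateField ℚ F}
    (E : IntermediateField L F) {x₀ y₀ : F} (hx : x₀ ∈ E) (hy : y₀ ∈ E) (R : ℚ[X][X]) :
    aevalAeval x₀ y₀ R ∈ E := by
  induction R using Polynomial.induction_on' with
  | add p q hp hq => rw [map_add]; exact add_mem hp hq
  | monomial n c =>
    rw [← C_mul_X_pow_eq_monomial, map_mul, map_pow, aevalAeval_C, aevalAeval_Y]
    refine mul_mem ?_ (pow_mem hy n)
    induction c using Polynomial.induction_on' with
    | add p q hp hq => rw [map_add]; exact add_mem hp hq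
    | monomial m q =>
      rw [← C_mul_X_pow_eq_monomial, map_mul, map_pow, aeval_C, aeval_X]
      refine mul_mem ?_ (pow_mem hx m)
      rw [IsScalarTower.algebraMap_apply ℚ L F]
      exact E.algebraMap_mem _

/-- S2 (PROVED): in every model, `[F : ℚ(y)] ≤ xdeg P`. -/
theorem finrank_adjoin_y_le {P : ℤ[X][X]} (hk : 1 ≤ xdeg P) (M : SiegelModel P) :
    Module.finrank ℚ⟮M.y⟯ M.F ≤ xdeg P := by
  classical
  set L : IntermediateField ℚ M.F := ℚ⟮M.y⟯ with hL
  have hyL : M.y ∈ L := IntermediateField.mem_adjoin_simple_self ℚ M.y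
  set yL : L := ⟨M.y, hyL⟩ with hyL'
  have hyval : algebraMap L M.F yL = M.y := rfl
  set S : ℚ[X][X] := Bivariate.swap (ratModel P) with hS
  set Q : L[X] := S.map (aeval yL : ℚ[X] →ₐ[ℚ] L).toRingHom with hQ
  -- `x` is a root of `Q`
  have hmon : ∀ (T : ℚ[X][X]), aeval M.x (T.map (aeval yL : ℚ[X] →ₐ[ℚ] L).toRingHom) = aevalAeval M.y M.x T := by
    intro T
    induction T using Polynomial.induction_on' with
    | add p q hp hq => rw [Polynomial.map_add, map_add, map_add, hp, hq]
    | monomial n c =>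
      rw [← C_mul_X_pow_eq_monomial, Polynomial.map_mul, Polynomial.map_pow, Polynomial.map_C, map_X, map_mul,
        map_pow, aeval_C, aeval_X, map_mul, map_pow, aevalAeval_C, aevalAeval_Y]
      congr 1
      change algebraMap L M.F (aeval yL c) = _
      rw [← aeval_algebraMap_apply, hyval]
  have hQx : aeval M.x Q = 0 := by
    rw [hQ, hmon, hS, Bivariate.aevalAeval_swap]
    exact (M.ker_iff _).2 dvd_rfl
  -- `Q ≠ 0`, of degree `≤ xdeg P`
  have hP0 : P ≠ 0 := by
    rintro rfl
    rw [← natDegree_swap, map_zero, natDegree_zero] at hk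
    omega
  have hS0 : S ≠ 0 := by
    rw [hS, Ne, EmbeddingLike.map_eq_zero_iff]
    intro h
    exact hP0 (map_injective _ (map_injective _ (RingHom.injective_int _)) (by rw [← ratModel, h, Polynomial.map_zero]))
  have hSk : S.natDegree = xdeg P := by rw [hS, natDegree_swap_ratModel]
  have hQ0 : Q ≠ 0 := by
    intro hQ0
    have h1 : Q.coeff S.natDegree = 0 := by rw [hQ0, coeff_zero]
    rw [hQ, coeff_map] at h1
    have h2 : aeval M.y (S.coeff S.natDegree) = 0 := by
      rw [← hyval, aeval_algebraMap_apply]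
      change algebraMap L M.F ((aeval yL : ℚ[X] →ₐ[ℚ] L).toRingHom (S.coeff S.natDegree)) = 0
      rw [h1, map_zero]
    exact M.transcendental_y hk ⟨S.coeff S.natDegree, leadingCoeff_ne_zero.2 hS0, h2⟩
  have hQdeg : Q.natDegree ≤ xdeg P := (natDegree_map_le).trans hSk.le
  -- degree of `x` over `L`
  have hint : IsIntegral L M.x := (isAlgebraic_iff_isIntegral).1 ⟨Q, hQ0, hQx⟩
  have hmin : (minpoly L M.x).natDegree ≤ xdeg P :=
    (natDegree_le_natDegree (minpoly.degree_le_of_ne_zero L M.x hQ0 hQx)).trans hQdeg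
  -- `F = L(x)`
  have htop : L⟮M.x⟯ = ⊤ := by
    rw [eq_top_iff]
    intro z _
    obtain ⟨G, H, hH0, hGH⟩ := M.exists_frac z
    have hxE : M.x ∈ L⟮M.x⟯ := IntermediateField.mem_adjoin_simple_self L M.x
    have hyE : M.y ∈ L⟮M.x⟯ := by simpa [hyval] using (L⟮M.x⟯).algebraMap_mem yL
    rw [(eq_div_iff hH0).2 hGH]
    exact div_mem (aevalAeval_mem _ hxE hyE _) (aevalAeval_mem _ hxE hyE _)
  calc Module.finrank L M.F = Module.finrank L (⊤ : IntermediateField L M.F) :=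
        (IntermediateField.finrank_top').symm
    _ = Module.finrank L L⟮M.x⟯ := by rw [htop]
    _ = (minpoly L M.x).natDegree := IntermediateField.adjoin.finrank hint
    _ ≤ xdeg P := hmin

/-- S2 (PROVED). -/
theorem degYBound : DegYBound := by
  intro P hk M
  rw [degree_negPart_principalDivisor_eq (M.transcendental_y hk)]
  exact_mod_cast finrank_adjoin_y_le hk M

end Summit.Schanuel.Schanuel.Theorems.RootDecomp1KSiegelFunctions

end
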